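import Literature.AlgebraicGeometry.Motives.AbelianVarietySubvarietyQuasiIdempotentImage
import Literature.AlgebraicGeometry.Motives.AbelianVarietySubvarietyFactorisationAnyField
import Literature.AlgebraicGeometry.Motives.AbelianVarietyQuasiIdempotentImageDual
import Mathlib.NumberTheory.NumberField.CMField
import Mathlib.RingTheory.Flat.Basic
import HarnessLib

/-!
# The simple CM factor as a QUOTIENT of `Im u₀`, compatible with `A ↠ Im u₀`: a quasi-idempotent `u` of `A` built
# through `toImage u₀`, the quotient map `ψ : Im u₀ ⟶ Im u` with `toImage u₀ ≫ ψ = toImage u`, and `ᵗV_ℓ ψ` injective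

[Liu2021] App. D §D.4 (FJcycle.tex l. 5626–5627): «Using Hecke operators, we may find a surjective homomorphism
`φ : A_K → B` … Let `B_0` be some simple factor of `B`» — the simple factor is taken as a QUOTIENT of the Hecke cut
`B = Im u₀`, through which `A_K ↠ B ↠ B_0` factors.  D. Mumford, *Abelian Varieties* (1970), §19 Thm. 1 and proof of
Cor. 2 (pp. 173–174) (images of homomorphisms are abelian subvarieties; Poincaré's quasi-retraction) and Thm. 3
(p. 176) (`V_ℓ` is a functor, `V_ℓ` of a quotient map is surjective).

Sequel of ★ `AbelianVarietySubvarietyQuasiIdempotentImage` (p745894), which realises the simple factor as `Im u` for a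
quasi-idempotent `u` of `A` but does not export a map `Im u₀ ⟶ Im u`.  THIS FILE (theorems only; no definition, no named
fact, no instance, no `sorry`) rebuilds `u` THROUGH the quotient map `toImage u₀ : A ⟶ Im u₀`:
* §1 `exists_hom_comp_imageι_eq_and_toImage_comp_eq` — for any `g : Im u₀ ⟶ A`, the endomorphism `u := toImage u₀ ≫ g`
  has `Im u = Im g` inside `A`, whence a unique `ψ : Im u₀ ⟶ Im u` with `ψ ≫ imageι u = g` and
  **`toImage u₀ ≫ ψ = toImage u`** (★ `existsUnique_hom_comp_eq_of_range_subset`, `toImage u₀` surjective);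
  `comp_self_eq_nsmul_of_quasiIdempotent` — for `g := w ≫ imageι u₀` with `w ≫ w = N • w` a quasi-idempotent of `Im u₀`
  and `u₀ ≫ u₀ = a₀ • u₀`: `u ≫ u = (a₀ N) • u`.
* §2 `rationalTateModuleMap_surjective_of_toImage_comp_eq`, **`dualMap_baseChange_injective_of_toImage_comp_eq`** —
  `toImage u₀ ≫ ψ = toImage u` with `u` quasi-idempotent ⟹ `V_ℓ ψ` surjective (★ `rationalTateModuleMap_toImage_surjective`)
  ⟹ `ᵗV_ℓ ψ ⊗ 1` injective over any field `L ⊇ ℚ_ℓ`.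
* §3 `isIsogenous_image_of_toImage_comp` — `Im w ∼ Im u ∼ Im w` (explicit quasi-inverse pair composing to `a₀N² • 𝟙`);
  **`exists_quasiIdempotent_toImage_comp_isSimple_numberField_of_comm_isReduced`** — p745894's conclusion (`Im u` simple,
  `0 < dim`, number field `M ≅ End⁰(Im u)` of degree `2 dim`) PLUS `∃ ψ, toImage u₀ ≫ ψ = toImage u`, from a commutative
  reduced `R ⊆ End⁰(Im u₀)` of degree `2 dim (Im u₀)`;
* §4 **`exists_cmQuotient_of_isCMField_of`** — over a number field `E`, the same in the binder order of the d6 line's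
  hypothesis shape (H2) `CMQuotientShape E`, taking the Rosati/Albert step «a number field of degree `2 dim B` inside
  `End⁰(B)` of a simple `B` is CM» as a hypothesis `hG` (G-ros, not proved here).

DICTIONARY LINE (cell `hodgecm-mathlib`, crux `HLiu418` = stmt-HodgeConjecture-24832, d6 S2′ producer (H2), residual
«(R2) quotient compatibility»): `A := C.A K`, `u₀ :=` the `ω⋆`-block quasi-idempotent, `R₀ :=` the multiplicity-one
algebra ((R-split)(b)); with G-ros supplying `hG`, `cmQuotientShape_of hG := fun ℓ _ A u₀ a₀ h₁ h₂ h₃ R₀ hc hr hd =>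
exists_cmQuotient_of_isCMField_of hG ℓ A u₀ a₀ h₁ h₂ h₃ R₀ hc hr hd`.  The file moves no book (HC_CM is proved only
modulo the 7 printed citations until rung 0 closes).

## References
* [MumfordAV1970] D. Mumford, *Abelian Varieties* (1970), §19 Thm. 1 and proof of Cor. 2 (pp. 173–174), Thm. 3 (p. 176).
* [Liu2021] Y. Liu, *Fourier–Jacobi cycles and arithmetic relative trace formula*, Camb. J. Math. 9 (2021), App. D §D.4
  (FJcycle.tex l. 5626–5627).
* [Shimura1998] G. Shimura, *Abelian Varieties with Complex Multiplication and Modular Functions* (1998), §5.1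
  Propositions 3 and 4 (p. 37), Proposition 6 (p. 39).
-/

set_option autoImplicit false

noncomputable section

open CategoryTheory CategoryTheory.Limits AlgebraicGeometry
open scoped TensorProduct

namespace Literature.AlgebraicGeometry.Motives

namespace AbelianVariety

universe u

/-! ### §1 An endomorphism through `toImage u₀` and the quotient map `Im u₀ ⟶ Im u` -/

section Quotient

variable {K : Type u} [Field K] {A : AbelianVariety K} (u₀ : A ⟶ A)

/-- **The quotient map.**  For `g : Im u₀ ⟶ A` and `u := toImage u₀ ≫ g`, the abelian subvarieties `Im u` and `Im g` of
`A` coincide (`toImage u₀` is surjective), so `g` factors uniquely as `ψ ≫ imageι u` and then `toImage u₀ ≫ ψ = toImage u`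
(`imageι u` is a monomorphism). [cite: MumfordAV1970, §19 Thm. 1 and proof of Cor. 2 (pp. 173–174)] [cite: Liu2021, App. D §D.4 (FJcycle.tex l. 5626–5627)] -/
theorem exists_hom_comp_imageι_eq_and_toImage_comp_eq (g : image u₀ ⟶ A) :
    ∃ ψ : image u₀ ⟶ image (toImage u₀ ≫ g),
      ψ ≫ imageι (toImage u₀ ≫ g) = g ∧ toImage u₀ ≫ ψ = toImage (toImage u₀ ≫ g) := by
  have hrange : Set.range (Hom.toSchemeHom g) ⊆ Set.range (Hom.toSchemeHom (imageι (toImage u₀ ≫ g))) := by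
    rw [range_toSchemeHom_imageι, range_toSchemeHom_comp_eq_of_surjective]
  obtain ⟨ψ, hψ, -⟩ := existsUnique_hom_comp_eq_of_range_subset g (imageι (toImage u₀ ≫ g)) hrange
  refine ⟨ψ, hψ, ?_⟩
  haveI := mono_of_isClosedImmersion_toSchemeHom (imageι (toImage u₀ ≫ g))
  rw [← cancel_mono (imageι (toImage u₀ ≫ g)), Category.assoc, hψ, toImage_imageι]

variable {u₀} {a₀ N : ℕ}

/-- `u := toImage u₀ ≫ w ≫ imageι u₀` is a quasi-idempotent: `u ≫ u = (a₀ N) • u` when `u₀ ≫ u₀ = a₀ • u₀` and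
`w ≫ w = N • w` (`imageι u₀ ≫ toImage u₀ = a₀ • 𝟙`). [cite: MumfordAV1970, §19 Thm. 1 and proof of Cor. 2 (pp. 173–174)] -/
theorem comp_self_eq_nsmul_of_quasiIdempotent (hu₀ : u₀ ≫ u₀ = a₀ • u₀) {w : image u₀ ⟶ image u₀}
    (hw : w ≫ w = N • w) :
    (toImage u₀ ≫ w ≫ imageι u₀) ≫ (toImage u₀ ≫ w ≫ imageι u₀) = (a₀ * N) • (toImage u₀ ≫ w ≫ imageι u₀) := by
  simp only [Category.assoc]
  rw [← Category.assoc (imageι u₀) (toImage u₀), imageι_comp_toImage_eq_nsmul_id hu₀, Preadditive.nsmul_comp,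
    Category.id_comp, Preadditive.comp_nsmul, ← Category.assoc w w, hw, Preadditive.nsmul_comp, Preadditive.comp_nsmul,
    Preadditive.comp_nsmul, ← mul_nsmul, mul_comm N a₀]

end Quotient

/-! ### §2 `V_ℓ ψ` is surjective, `ᵗV_ℓ ψ ⊗ 1` injective -/

section Tate

variable {K : Type u} [Field K] (ℓ : ℕ) [Fact ℓ.Prime] {A : AbelianVariety K} {u₀ u : A ⟶ A} {c : ℕ}

/-- **`V_ℓ ψ` is surjective** for `ψ : Im u₀ ⟶ Im u` with `toImage u₀ ≫ ψ = toImage u` and `u` a quasi-idempotent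
(`V_ℓ(toImage u) = V_ℓ ψ ∘ V_ℓ(toImage u₀)` is surjective). [cite: MumfordAV1970, §19 Thm. 3 (p. 176)] -/
theorem rationalTateModuleMap_surjective_of_toImage_comp_eq (hc : c ≠ 0) (hu : u ≫ u = c • u)
    {ψ : image u₀ ⟶ image u} (hψ : toImage u₀ ≫ ψ = toImage u) :
    Function.Surjective (rationalTateModuleMap ℓ ψ) := by
  have h := rationalTateModuleMap_toImage_surjective ℓ hu hc
  rw [← hψ, rationalTateModuleMap_comp, LinearMap.coe_comp] at h
  exact Function.Surjective.of_comp h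

/-- **`ᵗV_ℓ ψ ⊗_{ℚ_ℓ} L` is injective** (any field `L ⊇ ℚ_ℓ`, e.g. `ℚ̄_ℓ`): the dual of the surjection `V_ℓ ψ` is injective,
and a field extension is flat. [cite: MumfordAV1970, §19 Thm. 3 (p. 176)] [cite: Liu2021, App. D §D.4 (FJcycle.tex l. 5626–5627)] -/
theorem dualMap_baseChange_injective_of_toImage_comp_eq (hc : c ≠ 0) (hu : u ≫ u = c • u)
    {ψ : image u₀ ⟶ image u} (hψ : toImage u₀ ≫ ψ = toImage u) (L : Type*) [Field L] [Algebra ℚ_[ℓ] L] :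
    Function.Injective (((rationalTateModuleMap ℓ ψ).dualMap).baseChange L) := by
  have hinj : Function.Injective (rationalTateModuleMap ℓ ψ).dualMap :=
    LinearMap.dualMap_injective_of_surjective (rationalTateModuleMap_surjective_of_toImage_comp_eq ℓ hc hu hψ)
  rw [LinearMap.baseChange_eq_ltensor]
  exact Module.Flat.lTensor_preserves_injective_linearMap _ hinj

end Tate

/-! ### §3 The simple factor as `Im u`, `u` through `toImage u₀` -/

section Isogeny

variable {K : Type u} [Field K] {A : AbelianVariety K} {u₀ : A ⟶ A} {a₀ N : ℕ}

/-- **`Im w ∼ Im u` in both directions** for `u := toImage u₀ ≫ w ≫ imageι u₀` (`w` a quasi-idempotent of `Im u₀`, `u₀` of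
`A`, `a₀ N ≠ 0`): with the quotient map `ψ` (`ψ ≫ imageι u = w ≫ imageι u₀`), the pair `imageι w ≫ ψ : Im w ⟶ Im u` and
`imageι u ≫ toImage u₀ ≫ toImage w : Im u ⟶ Im w` composes to `(a₀ N²) • 𝟙` both ways, so both are isogenies.
[cite: MumfordAV1970, §19 Thm. 1 and proof of Cor. 2 (pp. 173–174)] -/
theorem isIsogenous_image_of_toImage_comp (ha₀ : a₀ ≠ 0) (hN : N ≠ 0) (hu₀ : u₀ ≫ u₀ = a₀ • u₀)
    {w : image u₀ ⟶ image u₀} (hw : w ≫ w = N • w) {ψ : image u₀ ⟶ image (toImage u₀ ≫ w ≫ imageι u₀)}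
    (hψ : ψ ≫ imageι (toImage u₀ ≫ w ≫ imageι u₀) = w ≫ imageι u₀) :
    (image w).IsIsogenous (image (toImage u₀ ≫ w ≫ imageι u₀)) ∧
      (image (toImage u₀ ≫ w ≫ imageι u₀)).IsIsogenous (image w) := by
  have huu := comp_self_eq_nsmul_of_quasiIdempotent hu₀ hw
  haveI := mono_of_isClosedImmersion_toSchemeHom (imageι (toImage u₀ ≫ w ≫ imageι u₀))
  -- `w ≫ ψ = N • ψ`
  have hwψ : w ≫ ψ = N • ψ := by
    rw [← cancel_mono (imageι (toImage u₀ ≫ w ≫ imageι u₀)), Category.assoc, hψ, ← Category.assoc, hw,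
      Preadditive.nsmul_comp, Preadditive.nsmul_comp, hψ]
  -- `Im w → Im u → Im w` is `a₀ N²`
  have h1 : (imageι w ≫ ψ) ≫ (imageι (toImage u₀ ≫ w ≫ imageι u₀) ≫ toImage u₀ ≫ toImage w) =
      (a₀ * N * N) • 𝟙 (image w) := by
    rw [Category.assoc, ← Category.assoc ψ, hψ, Category.assoc, ← Category.assoc (imageι u₀),
      imageι_comp_toImage_eq_nsmul_id hu₀, Preadditive.nsmul_comp, Category.id_comp, Preadditive.comp_nsmul,
      Preadditive.comp_nsmul, ← Category.assoc, imageι_comp_self_eq_nsmul_imageι hw, Preadditive.nsmul_comp,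
      imageι_comp_toImage_eq_nsmul_id hw, ← mul_nsmul, ← mul_nsmul]
    congr 1
    ring
  -- `Im u → Im w → Im u` is `a₀ N²`
  have h2 : (imageι (toImage u₀ ≫ w ≫ imageι u₀) ≫ toImage u₀ ≫ toImage w) ≫ (imageι w ≫ ψ) =
      (a₀ * N * N) • 𝟙 (image (toImage u₀ ≫ w ≫ imageι u₀)) := by
    rw [Category.assoc, Category.assoc, ← Category.assoc (toImage w), toImage_imageι, hwψ, Preadditive.comp_nsmul,
      Preadditive.comp_nsmul]
    have h3 : imageι (toImage u₀ ≫ w ≫ imageι u₀) ≫ toImage u₀ ≫ ψ = (a₀ * N) • 𝟙 _ := by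
      obtain ⟨ψ', -, hψ'⟩ := exists_hom_comp_imageι_eq_and_toImage_comp_eq u₀ (w ≫ imageι u₀)
      -- `toImage u₀ ≫ ψ = toImage u`: both `ψ` and `ψ'` lift `w ≫ imageι u₀`, and the lift is unique
      have hψeq : toImage u₀ ≫ ψ = toImage (toImage u₀ ≫ w ≫ imageι u₀) := by
        rw [← cancel_mono (imageι (toImage u₀ ≫ w ≫ imageι u₀)), Category.assoc, hψ, toImage_imageι]
      rw [hψeq, imageι_comp_toImage_eq_nsmul_id huu]
    rw [h3, ← mul_nsmul]
  have hc : a₀ * N * N ≠ 0 := mul_ne_zero (mul_ne_zero ha₀ hN) hN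
  have hle1 := dim_le_of_comp_eq_nsmul_id hc h1
  have hle2 := dim_le_of_comp_eq_nsmul_id hc h2
  have hdim : (image w).dim = (image (toImage u₀ ≫ w ≫ imageι u₀)).dim := le_antisymm hle1 hle2
  exact ⟨⟨imageι w ≫ ψ, (isIsogeny_of_comp_eq_nsmul_id_of_dim_eq hc h1 hdim).1⟩,
    ⟨_, (isIsogeny_of_comp_eq_nsmul_id_of_dim_eq hc h2 hdim.symm).1⟩⟩

end Isogeny

section Subfield

variable {k : Type} [Field k] [Algebra k ℂ] {A : AbelianVariety k}

/-- **The simple CM-candidate factor as the image of a quasi-idempotent `u` of `A` FACTORING THROUGH `A ↠ Im u₀`.**  For a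
quasi-idempotent `u₀` of `A` over `k ⊆ ℂ` (`u₀ ≫ u₀ = a₀ • u₀`, `a₀ ≠ 0`) and a commutative reduced `R ⊆ End⁰_k(Im u₀)` of
degree `2 dim (Im u₀) > 0`: there are `u : A ⟶ A`, `N ≠ 0` with `u ≫ u = N • u`, `Im u` SIMPLE of positive dimension, a
QUOTIENT MAP `ψ : Im u₀ ⟶ Im u` with `toImage u₀ ≫ ψ = toImage u`, and a number field `M` with a bijective
`j : M →+* End⁰_k(Im u)`, `[M : ℚ] = 2 dim (Im u)`.
[cite: Liu2021, App. D §D.4 (FJcycle.tex l. 5626–5627)] [cite: MumfordAV1970, §19 Thm. 1 and proof of Cor. 2 (pp. 173–174)]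
[cite: Shimura1998, §5.1 Propositions 3 and 4 (p. 37), Proposition 6 (p. 39)] -/
theorem exists_quasiIdempotent_toImage_comp_isSimple_numberField_of_comm_isReduced (u₀ : A ⟶ A) {a₀ : ℕ}
    (ha₀ : a₀ ≠ 0) (hu₀ : u₀ ≫ u₀ = a₀ • u₀)
    (R : Subalgebra ℚ (image u₀).endAlgebra) (hcomm : ∀ x ∈ R, ∀ y ∈ R, x * y = y * x) [IsReduced R]
    (hdeg : Module.finrank ℚ R = 2 * (image u₀).dim) (hpos : 0 < (image u₀).dim) :
    ∃ (u : A ⟶ A) (N : ℕ), N ≠ 0 ∧ u ≫ u = N • u ∧ (image u).IsSimple ∧ 0 < (image u).dim ∧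
      (∃ ψ : image u₀ ⟶ image u, toImage u₀ ≫ ψ = toImage u) ∧
      ∃ (M : Type) (_ : Field M) (_ : NumberField M) (j : M →+* (image u).endAlgebra),
        Function.Bijective j ∧ Module.finrank ℚ M = 2 * (image u).dim := by
  classical
  haveI : CharZero k := (algebraMap k ℂ).charZero
  -- split `Im u₀` by `R` and take the simple piece of one factor (as in p745894 §3)
  obtain ⟨ι, _, N₁, v, hN₁, -, hsum, -, hfac⟩ :=
    Literature.AlgebraicGeometry.ComplexMultiplication.exists_orthogonal_quasiIdempotents_isSimple_factor_of_comm_isReduced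
      R hcomm hdeg
  have hne : Nonempty ι := by
    by_contra hι
    haveI : IsEmpty ι := not_nonempty_iff.1 hι
    have h0 : (N₁ • 𝟙 (image u₀) : image u₀ ⟶ image u₀) = 0 := by
      rw [← hsum, Finset.univ_eq_empty, Finset.sum_empty]
    exact id_ne_zero_of_dim_pos hpos (hom_eq_zero_of_nsmul_eq_zero hN₁ h0)
  obtain ⟨i₀⟩ := hne
  obtain ⟨B, n, hn, hB, hiso, M, _, _, j, hj, hMdeg⟩ := hfac i₀
  obtain ⟨g, hg⟩ := hiso
  obtain ⟨g', m, hm, hgg', hg'g⟩ := IsIsogeny.exists_nsmul_inverse_holds hg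
  have hBpos : 0 < B.dim := by
    have := Module.finrank_pos (R := ℚ) (M := M)
    omega
  let f : B ⟶ image (v i₀) := biproduct.ι (fun _ : Fin n => B) ⟨0, hn⟩ ≫ g'
  have hf : f ≠ 0 := by
    intro hf0
    have h1 : f ≫ g ≫ biproduct.π (fun _ : Fin n => B) ⟨0, hn⟩ = m • 𝟙 B := by
      change (biproduct.ι _ _ ≫ g') ≫ g ≫ biproduct.π _ _ = _
      rw [Category.assoc, ← Category.assoc g' g, hg'g, Preadditive.nsmul_comp, Category.id_comp,
        Preadditive.comp_nsmul, biproduct.ι_π_self]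
    rw [hf0, zero_comp] at h1
    exact id_ne_zero_of_dim_pos hBpos (hom_eq_zero_of_nsmul_eq_zero hm.ne' h1.symm)
  -- `B → Im (v i₀) ↪ Im u₀`, non-zero, INSIDE `Im u₀`
  let F₀ : B ⟶ image u₀ := f ≫ imageι (v i₀)
  have hF₀ : F₀ ≠ 0 := by
    intro hF0
    haveI := mono_of_isClosedImmersion_toSchemeHom (imageι (v i₀))
    exact hf ((cancel_mono (imageι (v i₀))).1 (by rw [zero_comp]; exact hF0))
  -- a quasi-idempotent `w` of `Im u₀` with `B ∼ Im w`
  obtain ⟨w, N, hN, hww, hBw, hwB⟩ := exists_quasiIdempotent_isIsogenous_image_of_isSimple hB hF₀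
  -- `u := toImage u₀ ≫ w ≫ imageι u₀` and its quotient map
  obtain ⟨ψ, hψ, hψ'⟩ := exists_hom_comp_imageι_eq_and_toImage_comp_eq u₀ (w ≫ imageι u₀)
  obtain ⟨hwu, huw⟩ := isIsogenous_image_of_toImage_comp ha₀ hN hu₀ hww hψ
  have hBu : B.IsIsogenous (image (toImage u₀ ≫ w ≫ imageι u₀)) := hBw.trans hwu
  refine ⟨toImage u₀ ≫ w ≫ imageι u₀, a₀ * N, mul_ne_zero ha₀ hN, comp_self_eq_nsmul_of_quasiIdempotent hu₀ hww,
    IsSimple.of_isIsogenous hBu hB, ?_, ⟨ψ, hψ'⟩, ?_⟩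
  · rw [← hBu.dim_eq]; exact hBpos
  obtain ⟨e⟩ := hBu.nonempty_endAlgebra_algEquiv
  exact ⟨M, inferInstance, inferInstance, e.toRingEquiv.toRingHom.comp j, e.bijective.comp hj, by rw [hMdeg, hBu.dim_eq]⟩

end Subfield

/-! ### §4 The (H2) producer modulo the Rosati/Albert step -/

section NumberField

open NumberField

/-- **(H2) modulo G-ros, over a number field `E`** — in the binder order of the d6 line's hypothesis shape
`CMQuotientShape E`: for every prime `ℓ`, abelian variety `A/E`, quasi-idempotent `u₀` (`a₀ ≠ 0`, `u₀ ≫ u₀ = a₀ • u₀`,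
`0 < dim Im u₀`) and commutative reduced `R₀ ⊆ End⁰(Im u₀)` of degree `2 dim (Im u₀)`, there are a quasi-idempotent `u`, a
quotient map `ψ : Im u₀ ⟶ Im u` with `toImage u₀ ≫ ψ = toImage u` and `ᵗV_ℓ ψ ⊗ ℚ̄_ℓ` injective, and a CM field
`M ≅ End⁰(Im u)` of degree `2 dim (Im u)` — GIVEN the Rosati/Albert step `hG` («a number field of degree `2 dim B` filling
`End⁰(B)` of a simple `B` is a CM field», [Shimura1998] §5.1 Prop. 6), which this file does not prove.
[cite: Liu2021, App. D §D.4 (FJcycle.tex l. 5626–5627)] [cite: Shimura1998, §5.1 Propositions 3 and 4 (p. 37), Proposition 6 (p. 39)]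
[cite: MumfordAV1970, §19 Thm. 1 and proof of Cor. 2 (pp. 173–174), Thm. 3 (p. 176)] -/
theorem exists_cmQuotient_of_isCMField_of {E : Type} [Field E] [NumberField E]
    (hG : ∀ (B : AbelianVariety E), B.IsSimple → 0 < B.dim → ∀ (M : Type) [Field M] [NumberField M]
      (j : M →+* B.endAlgebra), Function.Bijective j → Module.finrank ℚ M = 2 * B.dim → IsCMField M)
    (ℓ : ℕ) [Fact ℓ.Prime] (A : AbelianVariety E) (u₀ : A ⟶ A) (a₀ : ℕ) (ha₀ : a₀ ≠ 0) (hu₀ : u₀ ≫ u₀ = a₀ • u₀)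
    (hpos : 0 < (image u₀).dim) (R₀ : Subalgebra ℚ (image u₀).endAlgebra) (hcomm : ∀ x ∈ R₀, ∀ y ∈ R₀, x * y = y * x)
    (hred : IsReduced R₀) (hdeg : Module.finrank ℚ R₀ = 2 * (image u₀).dim) :
    ∃ (u : A ⟶ A) (N : ℕ), N ≠ 0 ∧ u ≫ u = N • u ∧
      ∃ (ψ : image u₀ ⟶ image u), toImage u₀ ≫ ψ = toImage u ∧
        Function.Injective (((rationalTateModuleMap ℓ ψ).dualMap).baseChange (AlgebraicClosure ℚ_[ℓ])) ∧
        ∃ (M : Type) (_ : Field M) (_ : NumberField M) (_ : IsCMField M) (j : M →+* (image u).endAlgebra),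
          Function.Bijective j ∧ Module.finrank ℚ M = 2 * (image u).dim := by
  letI : Algebra E ℂ := (Classical.choice (inferInstance : Nonempty (E →+* ℂ))).toAlgebra
  haveI := hred
  obtain ⟨u, N, hN, huu, hsimple, hdim, ⟨ψ, hψ⟩, M, _, _, j, hj, hMdeg⟩ :=
    exists_quasiIdempotent_toImage_comp_isSimple_numberField_of_comm_isReduced u₀ ha₀ hu₀ R₀ hcomm hdeg hpos
  haveI : IsCMField M := hG (image u) hsimple hdim M j hj hMdeg
  exact ⟨u, N, hN, huu, ψ, hψ, dualMap_baseChange_injective_of_toImage_comp_eq ℓ hN huu hψ _, M, inferInstance,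
    inferInstance, inferInstance, j, hj, hMdeg⟩

end NumberField

end AbelianVariety

end Literature.AlgebraicGeometry.Motives

end
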